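import Literature.MathematicalPhysics.QuantumFieldTheory.Balaban1983to89.B3Eq14Finite
import Literature.MathematicalPhysics.QuantumFieldTheory.Balaban1983to89.HiggsFluctFamilyDensity
import Literature.MathematicalPhysics.QuantumFieldTheory.Balaban1983to89.B1Eq365Proof

/-!
# `Balaban1983to89.B1Eq335GeneratingFunction` — T. Bałaban, *(Higgs)₂,₃ quantum fields in a finite volume. I. A lower
bound*, Commun. Math. Phys. **85** (1982) 603–626 [Balaban1982Higgs1], p. 618: **the generating function `E_k` of (3.35)
WITH BODY on the concrete (Higgs)₂,₃ carrier**, its identification with the schematic decl of record (p14's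
`B1Eq365Proof.genFn335`) and with III's (1.4) (`B3Eq14AuxFunction.Data14.auxE`), and the perturbative formula (3.36) for
the action `S^{(k),L^kε}` built on it (r12's `B1Sect3Statements.Eq336R` by construction)

statement-level skeleton of published theorems with citation tags; proofs where landed; nothing here is a claim about the Yang–Mills mass gap

PDFs held: `paper:balaban1982-cmp85-higgs23-i` (journal page = PDF page + 602) and
`paper:balaban1983-higgs-2-3-quantum-fields-finite-volume` (journal page = PDF page + 410).  Displays read on the ×2 renders
`run/shared/lean/pub/pub-balaban/b2b-balaban-ref1/pages/1982-cmp85-higgs23-I/1982-cmp85-higgs23-I-p016-x2.png` (p. 618),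
`…-p003-x2.png` (p. 605), `…-p011-x2.png` (p. 613), never from the OCR layer.

CITATION HEADER (lean-in-tree rule).  lit-balaban typed skeleton (HOME `run/shared/lean/pub/lit-balaban/`), typer line
(the typer's carriers `HiggsLattice` / `HiggsAveraging` / `HiggsCovariance` / `HiggsFluctMeasure` / `B3Eq14AuxFunction`);
located member of the SKELETON rows **B1.Eq3.35** and **B1.Eq3.36** (rows of record r12 `lit-balaban-r12/ROWS-B1-part2.md`,
decls of record p14's `B1Eq365Proof.genFn335` (schematic: any measure `νA`, any kernels `t`, any density `ρ`) and r12's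
`B1Sect3Statements.Eq336R` / `pertSum362R`; B1 fold owner r14, PRE-AUDIT `READING-RULE-PREAUDIT-B1-part2-g23.md` §3 class E:
«generating functions … the carrier instance is not identified by a kernel theorem — natural owner p14/typer»).  Nothing of
r12's, r14's, r15's or p14's is edited or re-declared; everything is consumed BY NAME.

THE SOURCE TEXT, p. 618 [PDF 16], verbatim: *"We introduce an additional convention. It concerns the expressions
U(A(Γ^{(k)}_{y,x})) in the operators Q_k(A). We will change the definition of A(Γ^{(k)}_{y,x}) if we take the right side of
(3.33) instead of A. Making use of the definition (2.2) we assume A(Γ^{(k)}_{y,x}) = A^{(k),ε}(Γ^{(k)}_{y,x}) +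
Σ_{j=1}^{k−1} A′^{(j),ε}(Γ^{(j+1)}_{x_{j+1},x}), (3.34) where we have denoted x_k = y, x_0 = x. Now the perturbative formula
for the action S^{(k),L^kε} can be written. This formula for k = 1 follows from the close inspection of the procedures used
and the formulas obtained in the first step. Let us introduce at first the function
E_k(e′, λ′, eA^{(k),ε}, φ) = −log[(a(L^kε)^{d−2}/2π)^{(d/2)|T₁^{(k)}|} ∫dA′_{k−1} exp(−½⟨A′_{k−1}, (C^{(k−1),L^{k−1}ε})⁻¹A′_{k−1}⟩)·…
·(a(Lε)^{d−2}/2π)^{(d/2)|T₁^{(1)}|} ∫dA′₀ exp(−½⟨A′₀, (C^{(0),ε})⁻¹A′₀⟩)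
·T^ε_{a_k,L^k,eA^{(k),ε}+e′Σ_{j=0}^{k−1}A′^{(j),ε}}[exp(−½⟨φ′, (−Δ^ε_{eA^{(k),ε}+e′Σ_{j=0}^{k−1}A′^{(j),ε}})φ′⟩ − Σ_{x∈T_ε} ε^d𝒫(e′, λ′, φ(x)) − E)]],
𝒫(e′, λ′, φ) = λ′|φ|⁴ + ½δm²(e′, λ′)|φ|². (3.35)
The action S^{(k),L^kε} can be written in the form
S^{(k),L^kε}(A, φ) = ½⟨A, Δ^{(k),L^kε}A⟩ + Σ_{0≦α+β≦n̄} (1/(α!β!)) e^αλ^β (∂^{α+β}/∂e′^α∂λ′^β E_k(e′, λ′, eA^{(k),ε}, φ))|_{e′=λ′=0}. (3.36)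
From these formulas we can read out a graphical form of the expression above, i.e. its vertices and propagators. We will not
need them here."*; p. 617 [PDF 15]: *"A^{(k),ε} = a_k(L^kε)^{−2}G^ε_kQ^*_kA, … (3.29)"*, *"A = A′^{(0),ε} + A′^{(1),ε} + … +
A′^{(k−1),ε} + A^{(k),ε}, (3.33) where A′^{(j),ε} are given by the formula (3.29) with A′_j instead of A. The fields A′_j … are
independent Gaussian random variables with the covariances C^{(j),L^jε}."*

HOW IT IS TYPED (reuse, nothing re-declared; `P` = the ε-lattice family of paper I, `P.mesh 0 = ε`, `P.mesh k = L^kε`).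
* `Data335` = the data of (3.35) besides the displayed arguments `(e′, λ′, eA^{(k),ε}, φ)`: the coupling `C` of the transports
  `U` (p. 605 `U(A) = exp(qεeA)`; (3.35) writes the charges ON THE FIELDS — `eA^{(k),ε}`, `e′ΣA′^{(j),ε}` — so the literal
  reading takes `C.e = 1`; any `C` is allowed), the vector-field mass `mu0sq = μ₀²` and precision `a` of the covariances
  `C^{(j),L^jε}` (typer `HiggsFluctMeasure`) and of `A′^{(j),ε}` (3.29) (r15 `B3MultiscaleFields.fluctPiece`), the counterterm
  `δm²(e′,λ′)` and the constant `E` — supplied, as printed.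
* `calP` = 𝒫; `extField` = the plain bond field `eA^{(k),ε} + e′Σ_{j<k}A′^{(j),ε}` of `−Δ^ε_{(·)}` (Neumann covariant Laplacian
  of `HiggsCovariance` on the whole torus `T_ε`); `avgQ335` = `Q_k` of (2.11) with the transports read through the convention
  (3.34) — r15's `B3MultiscaleFields.holK13` ⟦(3.34) PRINTS the lower summation limit `j = 1`; the typing follows III (1.3)
  p. 412 (`Σ_{j=0}^{k−1}`), which includes the piece `A′^{(0),ε}` on `Γ^{(1)}_{x₁,x}` exactly as the first step (3.6) transports
  with the full field `A ⊇ A′^{(0),ε}`; no statement depends on this reading note⟧; `kernel335` / `rt335` = the `k`-th order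
  transformation `T^ε_{a_k,L^k,𝒜}` of (2.4)/(2.10) on ALL of `T_ε` (r14's generic `B1RT.blockKernel` / `B1RT.rtOp`, precision
  `B1RT.prec a_k (L^kε) d`, `a_k = B1.aSeq a L k` (2.15)); `density335` = the bracket `exp(…)` of (3.35) ⟦print writes `φ(x)`
  inside `𝒫` for the integration variable `φ′(x)` (cf. (3.64) p. 624, which prints `φ′(x)`); typed as `φ′`⟧; `rtConst j` =
  `(a(L^{j+1}ε)^{d−2}/2π)^{(d/2)|T₁^{(j+1)}|}`; `famWeight` = `Π_j exp(−½⟨A′_j,(C^{(j),L^jε})⁻¹A′_j⟩)` (typer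
  `HiggsFluctMeasure.gaussWeight`, `(C^{(j)})⁻¹` = `precOp` by (2.30)); `bracket335` = the argument of `−log` with the printed
  NEST of Gaussian integrals read as ONE integral against the product Lebesgue measure `Π_j dA′_j` (Fubini–Tonelli reading);
  **`genFn335C` = (3.35)**.  READING NOTE (no repair asserted): (3.35) prints the quadratic form of `φ′` with `−Δ^ε_𝒜` ALONE —
  no scalar mass term (cf. (3.7) p. 613 «−Δ_A + m²ε²» and III (1.4) p. 412 «−Δ^η + m²(L^kε)²»); the typing is AS PRINTED, and
  the scalar mass, if wanted, is carried by the supplied `δm²(e′,λ′) ↦ m² + δm²(e′,λ′)` (`density335_eq_density14` below shows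
  that this is exactly III's massive form).
* `action336C` = **(3.36)**: `½⟨A, Δ^{(k),L^kε}A⟩` (typer `HiggsFluctMeasure.deltaK`, the vector-field operator (2.17)/(2.21))
  `+ Σ_{0≦α+β≦n̄}(1/(α!β!))e^αλ^β ∂^{α+β}_{e′^αλ′^β}E_k(e′,λ′,eA^{(k),ε},φ)|₀` (r12's one-sided `B1Sect3Statements.pertSum362R`, the
  reading of record of B1.Eq3.36 v1.1), `A^{(k),ε}` = (3.29) = r15's `B3MultiscaleFields.topPiece`.

WHAT IS PROVED (0 sorry; kernel identities and measure-theoretic bookkeeping only — no estimate of the paper is asserted).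
* §2 `avgQ335_eq_avgQ14`, `extField_eq`, `density335_eq_density14`, `kernel335_nonneg`, `density335_pos`, unfolding lemmas —
  the (3.35) objects ARE the (1.4) objects of `B3Eq14AuxFunction.Data14` at `Ω^{(k)} = T^{(k)}`, `Ω₁ = T_ε`, `g_k = 1`,
  `λ(L^kε) = 1`, `L^kε ↦ 1`, scalar mass `m2` with `δm² ↦ δm² − m2` (any `m2`: the two massive terms cancel — the reading note).
* §3 `integral_extendZero_univ` (the field integral over `φ′↾_Ω` for `Ω = T_ε` is the field integral over `T_ε`),
  **`rt335_eq_rt14`**: `T^ε_{a_k,L^k,𝒜}[F]` on `T_ε` = III's `T^η[Ω, F]` at `Ω = T_ε`.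
* §4 **`genFn335C_eq_genFn335`**: (3.35) WITH BODY **is** p14's schematic `B1Eq365Proof.genFn335 νA t ρ φ e′ λ′` at `νA :=
  nu335` (the printed weighted measure `(Π_j rtConst_j)·famWeight·Π_j dA′_j`), `t := kernel335`, `ρ := density335`.
* §5 **`bracket335_eq_mul_integral_fluctFamily`**: for `μ₀² > 0`, `a > 0`, `L > 1`, `k ≤ K` the bracket of (3.35) equals
  `(Π_j rtConst_j · Z_j) · ∫ T[ρ](φ) dΠ_j dμ_{C^{(j),L^jε}}` (`Z_j = HiggsFluctMeasure.gaussNorm`, III's probability measures;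
  typer `HiggsFluctFamilyDensity.integral_fluctFamily`), i.e. `= (Π_j rtConst_j·Z_j)·∫ integrand14 dfluctFamily`
  (`bracket335_eq_mul_integral_integrand14`); hence **`genFn335C_eq_auxE_sub_log`**: `E_k^{(3.35)} = E_k^{(III.1.4)} −
  log Π_j rtConst_jZ_j` whenever the (1.4)-integral is non-zero, in particular (`genFn335C_eq_auxE_sub_log_of_pos`, typer
  `B3Eq14Finite.integral_integrand14_pos`) for `1 ≤ k`, `λ′ ≥ 0` and (`λ′ > 0` or `δm²(e′,λ′) > 0`).
* §6 `action336C`, **`eq336R_action336C`** (r12's `Eq336R` holds for the action (3.36) built on `genFn335C`, by `rfl`),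
  `action336C_eq` (the display).
HONEST SCOPE.  Definitions with bodies + identities; the `−log` is the real logarithm of a real integral exactly as printed
(p. 624: *"the formula is not well defined because the expression in the exponent is … not necessarily positive"* — nothing
about positivity beyond §5's sufficient condition is claimed); (3.64)/(3.65) on the carrier (the double transformation with
the convention (3.34), r14's `B1Eq214Concrete.renormTransf_renormTransfK`) are NOT here.  Unit `lit-balaban-typer` gen 31
(literature-prover-lit-balaban-typer-g31-0); HOME/FILED.md records the proposal.
-/

open scoped BigOperators ENNReal
open _root_.MeasureTheory

namespace Literature.MathematicalPhysics.QuantumFieldTheory.Balaban1983to89.B1Eq335GeneratingFunction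

open Literature.MathematicalPhysics.QuantumFieldTheory.Balaban1983to89.HiggsLattice
open Literature.MathematicalPhysics.QuantumFieldTheory.Balaban1983to89.HiggsAveraging
open Literature.MathematicalPhysics.QuantumFieldTheory.Balaban1983to89.HiggsCovariance
open Literature.MathematicalPhysics.QuantumFieldTheory.Balaban1983to89.B3MultiscaleFields
open Literature.MathematicalPhysics.QuantumFieldTheory.Balaban1983to89.HiggsFluctMeasure
open Literature.MathematicalPhysics.QuantumFieldTheory.Balaban1983to89.B1RT
open Literature.MathematicalPhysics.QuantumFieldTheory.Balaban1983to89.B3Eq14AuxFunction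

variable {P : HiggsLattice.Params} {N : ℕ}

/-! ## 1. The data of (3.35) and its dictionary to III's (1.4) data -/

/-- The data entering (3.35) p. 618 besides the displayed arguments `(e′, λ′, eA^{(k),ε}, φ)`: the coupling `C` of the
transports `U` (p. 605; the charges are written on the fields in (3.35), so the literal instance has `C.e = 1`), the
vector-field mass `μ₀²` and the precision `a` of the fluctuation covariances `C^{(j),L^jε}` and of the fields (3.29), the
mass counterterm `δm²(e′, λ′)` of `𝒫` and the constant `E`. [cite: Balaban1982Higgs1, (3.35) p.618] -/
structure Data335 (P : HiggsLattice.Params) (N k : ℕ) where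
  C : ChargeData N
  mu0sq : ℝ
  a : ℝ
  dm2 : ℝ → ℝ → ℝ
  E : ℝ

namespace Data335

variable {k : ℕ} (D : Data335 P N k)

/-- The dictionary (3.35) ↦ III (1.4): the data of `B3Eq14AuxFunction.Data14` with `Ω^{(k)} = T^{(k)}` (so `Ω = T_ε`),
`Ω₁ = T_ε`, `g_k = 1`, `λ(L^kε) = 1`, `L^kε ↦ 1`, a scalar mass `m2` and the counterterm `δm²(e′,λ′) − m2` (for every `m2`
the two mass terms of (1.4) cancel against each other, `density335_eq_density14`: (3.35) prints no scalar mass), `E₁ = E`.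
[cite: Balaban1983Higgs3, (1.4) p.412] -/
def toData14 (m2 : ℝ) : Data14 P N k where
  C := D.C
  msq := D.mu0sq
  a := D.a
  Ωk := Finset.univ
  Ω₁ := Finset.univ
  g := fun _ => 1
  m2 := m2
  ell := 1
  lamRun := 1
  dm2 := fun e' l' _ => D.dm2 e' l' - m2
  E1 := fun _ _ => D.E

/-- The region of the dictionary data is the whole `ε`-lattice (`Ω = B^k(T^{(k)}) = T_ε`). [cite: Balaban1982Higgs1, (2.10) p.609] -/
theorem toData14_Ω (m2 : ℝ) : (D.toData14 m2).Ω = Finset.univ := region_univ k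

/-- Every site lies in the region of the dictionary data. [cite: Balaban1982Higgs1, (2.10) p.609] -/
theorem mem_toData14_Ω (m2 : ℝ) (x : HiggsLattice.Site P 0) : x ∈ (D.toData14 m2).Ω := by
  rw [toData14_Ω]; exact Finset.mem_univ x

/-! ## 2. The objects of (3.35) with bodies -/

/-- **`𝒫(e′, λ′, φ) = λ′|φ|⁴ + ½δm²(e′, λ′)|φ|²`** — the second line of (3.35) p. 618 (`φ ∈ ℝ^N` a field value).
[cite: Balaban1982Higgs1, (3.35) p.618] -/
noncomputable def calP (e' l' : ℝ) (v : EuclideanSpace ℝ (Fin N)) : ℝ :=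
  l' * ‖v‖ ^ 4 + (1 / 2 : ℝ) * D.dm2 e' l' * ‖v‖ ^ 2

/-- Unfolding of `calP`. [cite: Balaban1982Higgs1, (3.35) p.618] -/
theorem calP_eq (e' l' : ℝ) (v : EuclideanSpace ℝ (Fin N)) :
    D.calP e' l' v = l' * ‖v‖ ^ 4 + (1 / 2 : ℝ) * D.dm2 e' l' * ‖v‖ ^ 2 := rfl

/-- `Σ_{j=0}^{k−1} A′^{(j),ε}` for a family `(A′_j)_{j<k}` of fluctuation fields, `A′^{(j),ε}` *"given by the formula (3.29)
with A′_j instead of A"* (p. 617) = r15's `B3MultiscaleFields.fluctPiece`. [cite: Balaban1982Higgs1, (3.33) p.617] -/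
noncomputable def fluctSum (A' : (j : Fin k) → HiggsLattice.VecField P j) : HiggsLattice.VecField P 0 :=
  ∑ j : Fin k, fluctPiece D.mu0sq D.a j (A' j)

/-- The external field `𝒜 = eA^{(k),ε} + e′Σ_{j=0}^{k−1}A′^{(j),ε}` of (3.35) as a plain `ε`-lattice bond field (the
subscript of `−Δ^ε_{(·)}`; the argument `Ak` ↤ `eA^{(k),ε}`). [cite: Balaban1982Higgs1, (3.35) p.618] -/
noncomputable def extField (Ak : HiggsLattice.VecField P 0) (e' : ℝ) (A' : (j : Fin k) → HiggsLattice.VecField P j) : HiggsLattice.VecField P 0 :=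
  Ak + e' • D.fluctSum A'

/-- The pieces `e′A′^{(j),ε}`, `j < k`, of the fluctuation part of `𝒜` for the contour convention (3.34) (zero for
`j ≥ k`). [cite: Balaban1982Higgs1, (3.34) p.618] -/
noncomputable def extPieces (e' : ℝ) (A' : (j : Fin k) → HiggsLattice.VecField P j) (j : ℕ) : HiggsLattice.VecField P 0 :=
  if h : j < k then e' • fluctPiece D.mu0sq D.a j (A' ⟨j, h⟩) else 0

/-- **`Q_k(𝒜)` of (2.11) with the convention (3.34)**: `(Q_k(𝒜)φ′)(y) = L^{−kd} Σ_{x∈B^k(y)} U(𝒜(Γ^{(k)}_{y,x}))φ′(x)`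
with `𝒜(Γ^{(k)}_{y,x}) = eA^{(k),ε}(Γ^{(k)}_{y,x}) + Σ_j e′A′^{(j),ε}(Γ^{(j+1)}_{x_{j+1},x})` — the transport is r15's
`B3MultiscaleFields.holK13` (III (1.3), lower limit `j = 0`; see the module docstring on the printed `j = 1`).
[cite: Balaban1982Higgs1, (3.34) p.618] -/
noncomputable def avgQ335 (Ak : HiggsLattice.VecField P 0) (e' : ℝ) (A' : (j : Fin k) → HiggsLattice.VecField P j) (φ' : HiggsLattice.ScalarField P 0 N) :
    HiggsLattice.ScalarField P k N :=
  fun y => (((P.L : ℝ) ^ (k * P.d))⁻¹) • ∑ x ∈ blockK k y, holK13 D.C k (D.extPieces e' A') Ak x (φ' x)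

/-- **The kernel `t^ε_{a_k,L^k,𝒜}(φ, φ′) = Π_{y∈T^{(k)}} (a_k(L^kε)^{d−2}/2π)^{N/2} exp(−½a_k(L^kε)^{d−2}|φ(y) − (Q_k(𝒜)φ′)(y)|²)`**
of (2.5)/(2.10) p. 608–609 on the WHOLE torus, for the field `𝒜` of (3.35) read through (3.34): r14's generic
`B1RT.blockKernel` (block lattice `T^{(k)}`, fine lattice `T_ε`, precision `B1RT.prec a_k (L^kε) d`).
[cite: Balaban1982Higgs1, (2.10) p.609] -/
noncomputable def kernel335 (Ak : HiggsLattice.VecField P 0) (e' : ℝ) (A' : (j : Fin k) → HiggsLattice.VecField P j) (φ : HiggsLattice.ScalarField P k N)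
    (φ' : HiggsLattice.ScalarField P 0 N) : ℝ :=
  blockKernel (prec (B1.aSeq D.a P.L k) (P.mesh k) P.d) (fun ψ' y => D.avgQ335 Ak e' A' ψ' y) φ φ'

/-- Unfolding of `kernel335` as the printed product over `y ∈ T^{(k)}`. [cite: Balaban1982Higgs1, (2.10) p.609] -/
theorem kernel335_eq (Ak : HiggsLattice.VecField P 0) (e' : ℝ) (A' : (j : Fin k) → HiggsLattice.VecField P j) (φ : HiggsLattice.ScalarField P k N)
    (φ' : HiggsLattice.ScalarField P 0 N) :
    D.kernel335 Ak e' A' φ φ'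
      = ∏ y : HiggsLattice.Site P k, rtKernel (prec (B1.aSeq D.a P.L k) (P.mesh k) P.d) (φ y - D.avgQ335 Ak e' A' φ' y) := rfl

/-- **`T^ε_{a_k,L^k,𝒜}[F](φ) = ∫dφ′ t(φ, φ′)F(φ′)`** on the whole torus ((2.4) p. 608 with the kernel (2.10)): r14's
`B1RT.rtOp` (`∫dφ′` = product Lebesgue measure over the sites of `T_ε`). [cite: Balaban1982Higgs1, (2.4) p.608] -/
noncomputable def rt335 (Ak : HiggsLattice.VecField P 0) (e' : ℝ) (A' : (j : Fin k) → HiggsLattice.VecField P j) (F : HiggsLattice.ScalarField P 0 N → ℝ)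
    (φ : HiggsLattice.ScalarField P k N) : ℝ :=
  rtOp (D.kernel335 Ak e' A') F φ

/-- Unfolding of `rt335` as the printed integral. [cite: Balaban1982Higgs1, (2.4) p.608] -/
theorem rt335_eq (Ak : HiggsLattice.VecField P 0) (e' : ℝ) (A' : (j : Fin k) → HiggsLattice.VecField P j) (F : HiggsLattice.ScalarField P 0 N → ℝ)
    (φ : HiggsLattice.ScalarField P k N) :
    D.rt335 Ak e' A' F φ = ∫ φ' : HiggsLattice.ScalarField P 0 N, D.kernel335 Ak e' A' φ φ' * F φ' := rfl

/-- **The bracket of (3.35)** as a function of the old scalar field `φ′` on `T_ε`: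
`exp(−½⟨φ′, (−Δ^ε_𝒜)φ′⟩ − Σ_{x∈T_ε} ε^d𝒫(e′, λ′, φ′(x)) − E)`, `−Δ^ε_𝒜` = the covariant Laplacian (1.11)/(2.17) on the whole
torus (`HiggsCovariance.covLaplacianN … univ`, no mass term — as printed), scalar product (1.5). [cite: Balaban1982Higgs1, (3.35) p.618] -/
noncomputable def density335 (Ak : HiggsLattice.VecField P 0) (e' l' : ℝ) (A' : (j : Fin k) → HiggsLattice.VecField P j) (φ' : HiggsLattice.ScalarField P 0 N) : ℝ :=
  Real.exp (-(1 / 2 : ℝ) * siteInner φ' (covLaplacianN D.C Finset.univ (D.extField Ak e' A') φ')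
    - (∑ x : HiggsLattice.Site P 0, P.mesh 0 ^ P.d * D.calP e' l' (φ' x)) - D.E)

/-- Unfolding of `density335`. [cite: Balaban1982Higgs1, (3.35) p.618] -/
theorem density335_eq (Ak : HiggsLattice.VecField P 0) (e' l' : ℝ) (A' : (j : Fin k) → HiggsLattice.VecField P j) (φ' : HiggsLattice.ScalarField P 0 N) :
    D.density335 Ak e' l' A' φ'
      = Real.exp (-(1 / 2 : ℝ) * siteInner φ' (covLaplacianN D.C Finset.univ (D.extField Ak e' A') φ')
          - (∑ x : HiggsLattice.Site P 0, P.mesh 0 ^ P.d * D.calP e' l' (φ' x)) - D.E) := rfl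

/-- The bracket of (3.35) is positive. [cite: Balaban1982Higgs1, (3.35) p.618] -/
theorem density335_pos (Ak : HiggsLattice.VecField P 0) (e' l' : ℝ) (A' : (j : Fin k) → HiggsLattice.VecField P j) (φ' : HiggsLattice.ScalarField P 0 N) :
    0 < D.density335 Ak e' l' A' φ' :=
  Real.exp_pos _

/-- **The Gaussian prefactor `(a(L^{j+1}ε)^{d−2}/2π)^{(d/2)|T₁^{(j+1)}|}`** of the `∫dA′_j` factor of (3.35)
(`a(L^{j+1}ε)^{d−2}` = `B1RT.prec a (L^{j+1}ε) d`, `|T₁^{(j+1)}|` = the number of sites of `T^{(j+1)}`; real power).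
[cite: Balaban1982Higgs1, (3.35) p.618] -/
noncomputable def rtConst (j : ℕ) : ℝ :=
  (prec D.a (P.mesh (j + 1)) P.d / (2 * Real.pi)) ^ ((P.d : ℝ) / 2 * (Fintype.card (HiggsLattice.Site P (j + 1)) : ℝ))

/-- Unfolding of `rtConst`. [cite: Balaban1982Higgs1, (3.35) p.618] -/
theorem rtConst_eq (j : ℕ) :
    D.rtConst j = (prec D.a (P.mesh (j + 1)) P.d / (2 * Real.pi)) ^ ((P.d : ℝ) / 2 * (Fintype.card (HiggsLattice.Site P (j + 1)) : ℝ)) :=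
  rfl

/-- The prefactors are positive for `a > 0`. [cite: Balaban1982Higgs1, (3.35) p.618] -/
theorem rtConst_pos (ha : 0 < D.a) (j : ℕ) : 0 < D.rtConst j :=
  Real.rpow_pos_of_pos (div_pos (prec_pos ha (P.mesh_pos (j + 1)) P.d) (by positivity)) _

/-- **The Gaussian weights of (3.35)**: `Π_{j=0}^{k−1} exp(−½⟨A′_j, (C^{(j),L^jε})⁻¹A′_j⟩)` (typer
`HiggsFluctMeasure.gaussWeight`; `(C^{(j)})⁻¹ = a(L^{j+1}ε)^{−2}P + Δ^{(j),L^jε}` by (2.30)). [cite: Balaban1982Higgs1, (3.35) p.618] -/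
noncomputable def famWeight (A' : (j : Fin k) → HiggsLattice.VecField P j) : ℝ :=
  ∏ j : Fin k, gaussWeight P D.mu0sq D.a j (A' j)

/-- The Gaussian weights are positive. [cite: Balaban1982Higgs1, (3.35) p.618] -/
theorem famWeight_pos (A' : (j : Fin k) → HiggsLattice.VecField P j) : 0 < D.famWeight A' :=
  Finset.prod_pos fun j _ => gaussWeight_pos D.mu0sq D.a j (A' j)

/-- **The argument of `−log` in (3.35)**: `(Π_j rtConst_j) · ∫ Π_j dA′_j (Π_j e^{−½⟨A′_j,(C^{(j)})⁻¹A′_j⟩})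
· T^ε_{a_k,L^k,𝒜}[density](φ)` — the printed nest `c_{k−1}∫dA′_{k−1}e^{…}·…·c₀∫dA′₀e^{…}·T[…]` read as ONE integral against
the product Lebesgue measure of the fluctuation fields (Fubini–Tonelli reading of the iterated Gaussian integrals).
[cite: Balaban1982Higgs1, (3.35) p.618] -/
noncomputable def bracket335 (e' l' : ℝ) (Ak : HiggsLattice.VecField P 0) (φ : HiggsLattice.ScalarField P k N) : ℝ :=
  (∏ j : Fin k, D.rtConst j) *
    ∫ A' : (j : Fin k) → HiggsLattice.VecField P j, D.famWeight A' * D.rt335 Ak e' A' (D.density335 Ak e' l' A') φ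

/-- **(3.35)** p. 618 [PDF 16] — the generating function `E_k(e′, λ′, eA^{(k),ε}, φ)` WITH BODY: minus the logarithm of
`bracket335` (arguments in the printed order; `Ak` ↤ `eA^{(k),ε}`, `φ` the new scalar field on `T^{(k)}`).
[cite: Balaban1982Higgs1, (3.35) p.618] -/
noncomputable def genFn335C (e' l' : ℝ) (Ak : HiggsLattice.VecField P 0) (φ : HiggsLattice.ScalarField P k N) : ℝ :=
  -Real.log (D.bracket335 e' l' Ak φ)

/-- Unfolding of `genFn335C` = (3.35) as printed. [cite: Balaban1982Higgs1, (3.35) p.618] -/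
theorem genFn335C_eq (e' l' : ℝ) (Ak : HiggsLattice.VecField P 0) (φ : HiggsLattice.ScalarField P k N) :
    D.genFn335C e' l' Ak φ
      = -Real.log ((∏ j : Fin k, D.rtConst j) *
          ∫ A' : (j : Fin k) → HiggsLattice.VecField P j, D.famWeight A' *
            ∫ φ' : HiggsLattice.ScalarField P 0 N, D.kernel335 Ak e' A' φ φ' * D.density335 Ak e' l' A' φ') := rfl

/-! ### The (3.35) objects are III's (1.4) objects at `Ω = Ω₁ = T_ε`, `g_k = 1` -/

/-- The pieces of (3.34) are the pieces of III's external field at `g_k = 1`. [cite: Balaban1983Higgs3, (1.3) p.412] -/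
theorem extPieces_eq (m2 e' : ℝ) (A' : (j : Fin k) → HiggsLattice.VecField P j) :
    D.extPieces e' A' = (D.toData14 m2).extPieces e' A' := by
  funext j
  by_cases h : j < k
  · rw [(D.toData14 m2).extPieces_of_lt e' A' h]
    simp only [extPieces, h, dif_pos, toData14, siteMul_one]
  · simp only [extPieces, h, dif_neg, not_false_eq_true, Data14.extPieces]

/-- `𝒜` of (3.35) is III's `e′g_kA′ + A^{(k)}` at `g_k = 1`. [cite: Balaban1983Higgs3, (1.4) p.412] -/
theorem extField_eq (m2 : ℝ) (Ak : HiggsLattice.VecField P 0) (e' : ℝ) (A' : (j : Fin k) → HiggsLattice.VecField P j) :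
    D.extField Ak e' A' = (D.toData14 m2).extField Ak e' A' := by
  rw [Data14.extField_eq, extField, add_comm]
  simp only [toData14, siteMul_one, Data14.fluctSum, fluctSum]

/-- **`Q_k(𝒜)` with (3.34) = III's `Q_k(e′g_kA′ + A^{(k)})` with (1.3)** at `g_k = 1` (`Data14.avgQ14`).
[cite: Balaban1983Higgs3, (1.3) p.412] -/
theorem avgQ335_eq_avgQ14 (m2 : ℝ) (Ak : HiggsLattice.VecField P 0) (e' : ℝ) (A' : (j : Fin k) → HiggsLattice.VecField P j)
    (φ' : HiggsLattice.ScalarField P 0 N) :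
    D.avgQ335 Ak e' A' φ' = (D.toData14 m2).avgQ14 Ak e' A' φ' := by
  funext y
  rw [Data14.avgQ14_apply, avgQ335, D.extPieces_eq m2]
  rfl

/-- `Σ_x ε^d 𝒫(e′,λ′,φ′(x)) = λ′Σ_x ε^d|φ′(x)|⁴ + ½δm²(e′,λ′)Σ_x ε^d|φ′(x)|²`. [cite: Balaban1982Higgs1, (3.35) p.618] -/
theorem sum_calP (e' l' : ℝ) (φ' : HiggsLattice.ScalarField P 0 N) :
    ∑ x : HiggsLattice.Site P 0, P.mesh 0 ^ P.d * D.calP e' l' (φ' x)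
      = l' * ∑ x : HiggsLattice.Site P 0, P.mesh 0 ^ P.d * ‖φ' x‖ ^ 4
        + (1 / 2 : ℝ) * D.dm2 e' l' * ∑ x : HiggsLattice.Site P 0, P.mesh 0 ^ P.d * ‖φ' x‖ ^ 2 := by
  simp only [calP, mul_add, Finset.sum_add_distrib, Finset.mul_sum]
  congr 1 <;> exact Finset.sum_congr rfl fun x _ => by ring

/-- **The bracket of (3.35) is III's density of (1.4)** at the dictionary data, for EVERY scalar mass `m2` (the terms
`−½m2⟨φ′,φ′⟩` and `+½m2Σε^d|φ′|²` cancel: (3.35) carries no scalar mass). [cite: Balaban1983Higgs3, (1.4) p.412] -/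
theorem density335_eq_density14 (m2 : ℝ) (Ak : HiggsLattice.VecField P 0) (e' l' : ℝ) (A' : (j : Fin k) → HiggsLattice.VecField P j)
    (φ' : HiggsLattice.ScalarField P 0 N) :
    D.density335 Ak e' l' A' φ' = (D.toData14 m2).density14 Ak e' l' A' φ' := by
  rw [Data14.density14_eq, density335_eq, Data14.scalarOp_eq, ← D.extField_eq m2, toData14_Ω, sum_calP]
  have hΩ₁ : (D.toData14 m2).Ω₁ = Finset.univ := rfl
  have hrun : (D.toData14 m2).lamRun = 1 := rfl
  have hell : (D.toData14 m2).ell = 1 := rfl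
  have hm2 : (D.toData14 m2).m2 = m2 := rfl
  have hdm2 : ∀ x, (D.toData14 m2).dm2 e' l' x = D.dm2 e' l' - m2 := fun _ => rfl
  have hE : (D.toData14 m2).E1 e' l' = D.E := rfl
  have hC : (D.toData14 m2).C = D.C := rfl
  simp only [hΩ₁, hrun, hell, hm2, hdm2, hE, hC]
  congr 1
  have hq : siteInner φ' ((covLaplacianN D.C Finset.univ (D.extField Ak e' A') + (m2 * (1 : ℝ) ^ 2) • LinearMap.id :
        HiggsLattice.ScalarField P 0 N →ₗ[ℝ] HiggsLattice.ScalarField P 0 N) φ')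
      = siteInner φ' (covLaplacianN D.C Finset.univ (D.extField Ak e' A') φ') + m2 * ∑ x : HiggsLattice.Site P 0, P.mesh 0 ^ P.d * ‖φ' x‖ ^ 2 := by
    rw [LinearMap.add_apply, LinearMap.smul_apply, LinearMap.id_apply, one_pow, mul_one]
    unfold siteInner
    rw [Finset.mul_sum, ← Finset.sum_add_distrib]
    refine Finset.sum_congr rfl fun x _ => ?_
    rw [Pi.add_apply, Pi.smul_apply, inner_add_right, real_inner_smul_right, real_inner_self_eq_norm_sq]
    ring
  rw [hq]
  have h2 : ∑ x : HiggsLattice.Site P 0, P.mesh 0 ^ P.d * (D.dm2 e' l' - m2) * (1 : ℝ) ^ 2 * ‖φ' x‖ ^ 2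
      = (D.dm2 e' l' - m2) * ∑ x : HiggsLattice.Site P 0, P.mesh 0 ^ P.d * ‖φ' x‖ ^ 2 := by
    rw [Finset.mul_sum]
    exact Finset.sum_congr rfl fun x _ => by ring
  rw [h2]
  ring

/-- The kernel (2.10) of (3.35) is III's kernel body at the dictionary data: for every field `φ′` on `T_ε`,
`t(φ, φ′) = Π_{y∈T^{(k)}} t(φ(y) − (Q_k φ′)(y))` with the SAME block average. [cite: Balaban1982Higgs1, (2.10) p.609] -/
theorem kernel335_eq_prod_avgQ14 (m2 : ℝ) (Ak : HiggsLattice.VecField P 0) (e' : ℝ) (A' : (j : Fin k) → HiggsLattice.VecField P j)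
    (φ : HiggsLattice.ScalarField P k N) (φ' : HiggsLattice.ScalarField P 0 N) :
    D.kernel335 Ak e' A' φ φ'
      = ∏ y : HiggsLattice.Site P k, rtKernel (prec (B1.aSeq D.a P.L k) (P.mesh k) P.d)
          (φ y - (D.toData14 m2).avgQ14 Ak e' A' φ' y) := by
  rw [kernel335_eq, D.avgQ335_eq_avgQ14 m2]

/-- The kernel is non-negative for `a ≥ 0`. [cite: Balaban1982Higgs1, (2.5) p.608] -/
theorem kernel335_nonneg (ha : 0 ≤ D.a) (Ak : HiggsLattice.VecField P 0) (e' : ℝ) (A' : (j : Fin k) → HiggsLattice.VecField P j)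
    (φ : HiggsLattice.ScalarField P k N) (φ' : HiggsLattice.ScalarField P 0 N) : 0 ≤ D.kernel335 Ak e' A' φ φ' := by
  rw [kernel335_eq]
  refine Finset.prod_nonneg fun y _ => rtKernel_nonneg ?_ _
  unfold prec
  exact mul_nonneg ((D.toData14 0).aSeq_nonneg' ha k) (zpow_nonneg (P.mesh_pos k).le _)

end Data335

/-! ## 3. `∫dφ′↾_Ω` for `Ω = T_ε` is `∫dφ′`: the transformation of (3.35) is III's `T^η[Ω, ·]` at `Ω = T_ε` -/

section WholeTorus

/-- For a region containing every site, restriction is an equivalence `Ω ≃ T_ε`. [cite: Balaban1982Higgs1, (2.10) p.609] -/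
def siteEquivOfForall (Ω : Finset (HiggsLattice.Site P 0)) (hΩ : ∀ x, x ∈ Ω) : ↥Ω ≃ HiggsLattice.Site P 0 :=
  Equiv.subtypeUnivEquiv hΩ

/-- The corresponding equivalence of field spaces `(Ω → ℝ^N) ≃ᵐ (T_ε → ℝ^N)`. [cite: Balaban1982Higgs1, (2.10) p.609] -/
noncomputable def fieldEquivOfForall (Ω : Finset (HiggsLattice.Site P 0)) (hΩ : ∀ x, x ∈ Ω) :
    (↥Ω → EuclideanSpace ℝ (Fin N)) ≃ᵐ HiggsLattice.ScalarField P 0 N :=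
  MeasurableEquiv.piCongrLeft (fun _ : HiggsLattice.Site P 0 => EuclideanSpace ℝ (Fin N)) (siteEquivOfForall Ω hΩ)

/-- The field equivalence IS the extension by zero of `B3Eq14AuxFunction` (nothing is outside `Ω`).
[cite: Balaban1982Higgs1, (2.10) p.609] -/
theorem fieldEquivOfForall_apply (Ω : Finset (HiggsLattice.Site P 0)) (hΩ : ∀ x, x ∈ Ω) (φΩ : ↥Ω → EuclideanSpace ℝ (Fin N)) :
    fieldEquivOfForall (N := N) Ω hΩ φΩ = extendZero Ω φΩ := by
  funext x
  have hx : x = siteEquivOfForall Ω hΩ ⟨x, hΩ x⟩ := rfl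
  rw [extendZero_of_mem Ω φΩ (hΩ x)]
  conv_lhs => rw [hx]
  rw [fieldEquivOfForall, MeasurableEquiv.coe_piCongrLeft, Equiv.piCongrLeft_apply_apply]

/-- The field equivalence preserves the product Lebesgue measures `dφ′`. [cite: Balaban1982Higgs1, (2.4) p.608] -/
theorem measurePreserving_fieldEquivOfForall (Ω : Finset (HiggsLattice.Site P 0)) (hΩ : ∀ x, x ∈ Ω) :
    MeasurePreserving (fieldEquivOfForall (N := N) Ω hΩ) volume volume :=
  volume_measurePreserving_piCongrLeft (fun _ : HiggsLattice.Site P 0 => EuclideanSpace ℝ (Fin N)) (siteEquivOfForall Ω hΩ)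

/-- **`∫dφ′↾_Ω F(φ′ extended by 0) = ∫dφ′ F(φ′)` when `Ω` is the whole lattice** (the case `Ω = T_ε` of (2.4)/(2.10),
p. 610: *"In this paper we will use the case Ω = T_ε only"*). [cite: Balaban1982Higgs1, (2.10) p.609] -/
theorem integral_extendZero_of_forall (Ω : Finset (HiggsLattice.Site P 0)) (hΩ : ∀ x, x ∈ Ω) (F : HiggsLattice.ScalarField P 0 N → ℝ) :
    ∫ φΩ : ↥Ω → EuclideanSpace ℝ (Fin N), F (extendZero Ω φΩ) = ∫ φ : HiggsLattice.ScalarField P 0 N, F φ := by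
  have h := (measurePreserving_fieldEquivOfForall (N := N) Ω hΩ).integral_comp
    (fieldEquivOfForall (N := N) Ω hΩ).measurableEmbedding F
  simp only [fieldEquivOfForall_apply] at h
  exact h

namespace Data335

variable {k : ℕ} (D : Data335 P N k)

/-- **`T^ε_{a_k,L^k,𝒜}[F]` of (3.35) on `T_ε` IS III's `T^η_{a_k,L^k,e′g_kA′+A^{(k)}}[Ω, F]` at `Ω = T_ε`, `g_k = 1`**
(`B3Eq14AuxFunction.Data14.rt14` of the dictionary data), for every density `F` and every new field `φ`.
[cite: Balaban1982Higgs1, (2.10) p.609] -/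
theorem rt335_eq_rt14 (m2 : ℝ) (Ak : HiggsLattice.VecField P 0) (e' : ℝ) (A' : (j : Fin k) → HiggsLattice.VecField P j)
    (F : HiggsLattice.ScalarField P 0 N → ℝ) (φ : HiggsLattice.ScalarField P k N) :
    D.rt335 Ak e' A' F φ = (D.toData14 m2).rt14 Ak e' A' F φ := by
  rw [Data335.rt335, Data14.rt14_eq, rtOp_eq]
  rw [← integral_extendZero_of_forall (D.toData14 m2).Ω (D.mem_toData14_Ω m2)
    (fun φ' => D.kernel335 Ak e' A' φ φ' * F φ')]
  refine integral_congr_ae (Filter.Eventually.of_forall fun φΩ => ?_)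
  show D.kernel335 Ak e' A' φ (extendZero (D.toData14 m2).Ω φΩ) * F (extendZero (D.toData14 m2).Ω φΩ)
    = (D.toData14 m2).kernel14 Ak e' A' φ φΩ * F (extendZero (D.toData14 m2).Ω φΩ)
  rw [D.kernel335_eq_prod_avgQ14 m2, Data14.kernel14_eq]
  congr 1
  exact (Finset.prod_coe_sort Finset.univ fun y : HiggsLattice.Site P k =>
    rtKernel (prec (B1.aSeq D.a P.L k) (P.mesh k) P.d) (φ y - (D.toData14 m2).avgQ14 Ak e' A' (extendZero (D.toData14 m2).Ω φΩ) y)).symm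

/-- Hence the `A′`-integrand of (3.35) is III's `integrand14` of the dictionary data. [cite: Balaban1983Higgs3, (1.4) p.412] -/
theorem rt335_density335_eq_integrand14 (m2 : ℝ) (e' l' : ℝ) (Ak : HiggsLattice.VecField P 0) (φ : HiggsLattice.ScalarField P k N)
    (A' : (j : Fin k) → HiggsLattice.VecField P j) :
    D.rt335 Ak e' A' (D.density335 Ak e' l' A') φ = (D.toData14 m2).integrand14 e' l' Ak φ A' := by
  have hρ : D.density335 Ak e' l' A' = (D.toData14 m2).density14 Ak e' l' A' :=
    funext fun φ' => D.density335_eq_density14 m2 Ak e' l' A' φ'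
  rw [Data14.integrand14, hρ, D.rt335_eq_rt14 m2]

end Data335

end WholeTorus

/-! ## 4. (3.35) WITH BODY is the schematic decl of record `B1Eq365Proof.genFn335` at the concrete data -/

section Schematic

variable {k : ℕ} (D : Data335 P N k)

namespace Data335

/-- **The printed weighted measure of (3.35)** on the fluctuation families `(A′_j)_{j<k}`:
`(Π_j rtConst_j) · (Π_j e^{−½⟨A′_j,(C^{(j),L^jε})⁻¹A′_j⟩}) · Π_j dA′_j` — p14's `νA` (*"ALL the fluctuation gauge fields
A′_k, …, A′_0 with the weighted measure Π_j (prefactor_j)·exp(−½⟨A′_j,(C^{(j)})⁻¹A′_j⟩)dA′_j of (3.35)"*).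
[cite: Balaban1982Higgs1, (3.35) p.618] -/
noncomputable def nu335 : Measure ((j : Fin k) → HiggsLattice.VecField P j) :=
  ENNReal.ofReal (∏ j : Fin k, D.rtConst j) •
    (volume : Measure ((j : Fin k) → HiggsLattice.VecField P j)).withDensity fun A' => ENNReal.ofReal (D.famWeight A')

/-- The family weight is continuous, hence measurable. [cite: Balaban1982Higgs1, (3.35) p.618] -/
theorem measurable_famWeight : Measurable D.famWeight := by
  unfold famWeight
  exact (HiggsFluctFamilyDensity.continuous_famWeight D.mu0sq D.a k).measurable

/-- Integration against the printed weighted measure: `∫ Ψ dν = (Π_j rtConst_j) · ∫ Π_j dA′_j (Π_j e^{…}) Ψ` (`a > 0`).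
[cite: Balaban1982Higgs1, (3.35) p.618] -/
theorem integral_nu335 (ha : 0 < D.a) (Ψ : ((j : Fin k) → HiggsLattice.VecField P j) → ℝ) :
    ∫ A', Ψ A' ∂D.nu335 = (∏ j : Fin k, D.rtConst j) * ∫ A' : (j : Fin k) → HiggsLattice.VecField P j, D.famWeight A' * Ψ A' := by
  rw [nu335, integral_smul_measure,
    integral_withDensity_eq_integral_toReal_smul₀ D.measurable_famWeight.ennreal_ofReal.aemeasurable
      (Filter.Eventually.of_forall fun _ => ENNReal.ofReal_lt_top)]
  have hc : 0 ≤ ∏ j : Fin k, D.rtConst j := Finset.prod_nonneg fun j _ => (D.rtConst_pos ha j).le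
  simp only [ENNReal.toReal_ofReal hc, ENNReal.toReal_ofReal (D.famWeight_pos _).le, smul_eq_mul]

/-- **(3.35) WITH BODY IS p14's SCHEMATIC (3.35)** — `B1Eq365Proof.genFn335 νA t ρ ψ e′ λ′ = −log ∫ T_{t(e′,a)}[ρ(e′,λ′,a)](ψ) dνA(a)`
at `νA := nu335` (the printed weighted measure), `t e′ A′ := kernel335 … e′ A′` (the kernel (2.10) of `T^ε_{a_k,L^k,𝒜}`,
`𝒜 = eA^{(k),ε} + e′ΣA′^{(j),ε}` read through (3.34)), `ρ e′ λ′ A′ := density335 … e′ λ′ A′`, `ψ := φ` (`a > 0`).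
[cite: Balaban1982Higgs1, (3.35) p.618] -/
theorem genFn335C_eq_genFn335 (ha : 0 < D.a) (e' l' : ℝ) (Ak : HiggsLattice.VecField P 0) (φ : HiggsLattice.ScalarField P k N) :
    D.genFn335C e' l' Ak φ
      = B1Eq365Proof.genFn335 D.nu335 (fun e₁ A' => D.kernel335 Ak e₁ A') (fun e₁ l₁ A' => D.density335 Ak e₁ l₁ A')
          φ e' l' := by
  rw [B1Eq365Proof.genFn335_eq, D.integral_nu335 ha, genFn335C, bracket335]
  rfl

end Data335

end Schematic

/-! ## 5. The bracket of (3.35) against III's probability measures `Π_j dμ_{C^{(j),L^jε}}` -/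

section Normalised

variable {k : ℕ} (D : Data335 P N k)

namespace Data335

/-- **(3.35)'s Gaussian integrals NORMALISED**: for `μ₀² > 0`, `a > 0`, `L > 1`, `k ≤ K`,
`(Π_j rtConst_j)·∫Π_j dA′_j(Π_j e^{−½⟨A′_j,(C^{(j)})⁻¹A′_j⟩})·T[ρ](φ) = (Π_j rtConst_j·Z_j)·∫ T[ρ](φ) dΠ_j dμ_{C^{(j),L^jε}}`,
`Z_j = ∫dA′_j e^{−½⟨A′_j,(C^{(j)})⁻¹A′_j⟩}` (`HiggsFluctMeasure.gaussNorm`), `dμ_{C^{(j)}}` III's probability measures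
(`HiggsFluctMeasure.fluctFamily`; typer `HiggsFluctFamilyDensity.integral_fluctFamily`). [cite: Balaban1982Higgs1, (3.35) p.618] -/
theorem bracket335_eq_mul_integral_fluctFamily (hmu : 0 < D.mu0sq) (ha : 0 < D.a) (hL : 1 < (P.L : ℝ)) (hk : k ≤ P.K)
    (e' l' : ℝ) (Ak : HiggsLattice.VecField P 0) (φ : HiggsLattice.ScalarField P k N) :
    D.bracket335 e' l' Ak φ
      = (∏ j : Fin k, D.rtConst j * gaussNorm P D.mu0sq D.a j) *
          ∫ A', D.rt335 Ak e' A' (D.density335 Ak e' l' A') φ ∂(fluctFamily P D.mu0sq D.a k) := by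
  rw [bracket335, Finset.prod_mul_distrib, HiggsFluctFamilyDensity.integral_fluctFamily hmu ha hL hk, smul_eq_mul]
  have hZ : ∀ j : Fin k, gaussNorm P D.mu0sq D.a j ≠ 0 :=
    fun j => (HiggsFluctMeasurePos.gaussNorm_pos hmu ha hL (HiggsFluctFamilyDensity.le_K_of_fin hk j)).ne'
  have hprod : (∏ j : Fin k, gaussNorm P D.mu0sq D.a j) * ∏ j : Fin k, (gaussNorm P D.mu0sq D.a j)⁻¹ = 1 := by
    rw [← Finset.prod_mul_distrib]
    exact Finset.prod_eq_one fun j _ => mul_inv_cancel₀ (hZ j)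
  simp only [smul_eq_mul, famWeight]
  calc (∏ j : Fin k, D.rtConst j) * ∫ A' : (j : Fin k) → HiggsLattice.VecField P j,
          (∏ j : Fin k, gaussWeight P D.mu0sq D.a j (A' j)) * D.rt335 Ak e' A' (D.density335 Ak e' l' A') φ
      = (∏ j : Fin k, D.rtConst j) * (((∏ j : Fin k, gaussNorm P D.mu0sq D.a j) * ∏ j : Fin k, (gaussNorm P D.mu0sq D.a j)⁻¹) *
          ∫ A' : (j : Fin k) → HiggsLattice.VecField P j,
            (∏ j : Fin k, gaussWeight P D.mu0sq D.a j (A' j)) * D.rt335 Ak e' A' (D.density335 Ak e' l' A') φ) := by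
        rw [hprod, one_mul]
    _ = (∏ j : Fin k, D.rtConst j) * (∏ j : Fin k, gaussNorm P D.mu0sq D.a j) *
          ((∏ j : Fin k, (gaussNorm P D.mu0sq D.a j)⁻¹) *
            ∫ A' : (j : Fin k) → HiggsLattice.VecField P j,
              (∏ j : Fin k, gaussWeight P D.mu0sq D.a j (A' j)) * D.rt335 Ak e' A' (D.density335 Ak e' l' A') φ) := by
        ring

/-- The same with III's integrand: the bracket of (3.35) `= (Π_j rtConst_j·Z_j) · ∫ integrand14 dΠ_j dμ_{C^{(j)}}` of the
dictionary data (any scalar mass `m2`). [cite: Balaban1983Higgs3, (1.4) p.412] -/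
theorem bracket335_eq_mul_integral_integrand14 (hmu : 0 < D.mu0sq) (ha : 0 < D.a) (hL : 1 < (P.L : ℝ)) (hk : k ≤ P.K)
    (m2 e' l' : ℝ) (Ak : HiggsLattice.VecField P 0) (φ : HiggsLattice.ScalarField P k N) :
    D.bracket335 e' l' Ak φ
      = (∏ j : Fin k, D.rtConst j * gaussNorm P D.mu0sq D.a j) *
          ∫ A', (D.toData14 m2).integrand14 e' l' Ak φ A' ∂(fluctFamily P D.mu0sq D.a k) := by
  rw [D.bracket335_eq_mul_integral_fluctFamily hmu ha hL hk]
  congr 1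
  refine integral_congr_ae (Filter.Eventually.of_forall fun A' => ?_)
  exact rt335_density335_eq_integrand14 D m2 e' l' Ak φ A'

/-- The normalisation constant `Π_j rtConst_j·Z_j` of the dictionary is positive. [cite: Balaban1982Higgs1, (3.35) p.618] -/
theorem normConst_pos (hmu : 0 < D.mu0sq) (ha : 0 < D.a) (hL : 1 < (P.L : ℝ)) (hk : k ≤ P.K) :
    0 < ∏ j : Fin k, D.rtConst j * gaussNorm P D.mu0sq D.a j :=
  Finset.prod_pos fun j _ => mul_pos (D.rtConst_pos ha j)
    (HiggsFluctMeasurePos.gaussNorm_pos hmu ha hL (HiggsFluctFamilyDensity.le_K_of_fin hk j))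

/-- **`E_k^{(3.35)} = E_k^{(III.1.4)} − log Π_j rtConst_jZ_j`**: paper I's generating function (3.35) and III's (1.4)
(`B3Eq14AuxFunction.Data14.auxE` of the dictionary data: `Ω = Ω₁ = T_ε`, `g_k = 1`) differ by the constant coming from the
two normalisations of the Gaussian integrals, whenever the (1.4)-integral is non-zero (`μ₀² > 0`, `a > 0`, `L > 1`, `k ≤ K`).
[cite: Balaban1983Higgs3, (1.4) p.412] -/
theorem genFn335C_eq_auxE_sub_log (hmu : 0 < D.mu0sq) (ha : 0 < D.a) (hL : 1 < (P.L : ℝ)) (hk : k ≤ P.K)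
    (m2 e' l' : ℝ) (Ak : HiggsLattice.VecField P 0) (φ : HiggsLattice.ScalarField P k N)
    (hI : (∫ A', (D.toData14 m2).integrand14 e' l' Ak φ A' ∂(fluctFamily P D.mu0sq D.a k)) ≠ 0) :
    D.genFn335C e' l' Ak φ
      = (D.toData14 m2).auxE e' l' Ak φ - Real.log (∏ j : Fin k, D.rtConst j * gaussNorm P D.mu0sq D.a j) := by
  have hauxE : (D.toData14 m2).auxE e' l' Ak φ
      = -Real.log (∫ A', (D.toData14 m2).integrand14 e' l' Ak φ A' ∂(fluctFamily P D.mu0sq D.a k)) := rfl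
  rw [genFn335C, D.bracket335_eq_mul_integral_integrand14 hmu ha hL hk m2, hauxE,
    Real.log_mul (D.normConst_pos hmu ha hL hk).ne' hI]
  ring

/-- The previous identity with the non-vanishing DISCHARGED by the typer's `B3Eq14Finite.integral_integrand14_pos`: for
`1 ≤ k ≤ K`, `μ₀² > 0`, `a > 0`, `L > 1`, a scalar mass `m2 > 0` in the dictionary, `λ′ ≥ 0` and (`λ′ > 0` or
`δm²(e′,λ′) > 0`) the (1.4)-integral is positive. [cite: Balaban1983Higgs3, (1.4) p.412] -/
theorem genFn335C_eq_auxE_sub_log_of_pos (hmu : 0 < D.mu0sq) (ha : 0 < D.a) (hL : 1 < (P.L : ℝ)) (hk1 : 1 ≤ k)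
    (hk : k ≤ P.K) {m2 : ℝ} (hm2 : 0 < m2) {e' l' : ℝ} (hl : 0 ≤ l') (hreg : 0 < l' ∨ 0 < D.dm2 e' l')
    (Ak : HiggsLattice.VecField P 0) (φ : HiggsLattice.ScalarField P k N) :
    D.genFn335C e' l' Ak φ
      = (D.toData14 m2).auxE e' l' Ak φ - Real.log (∏ j : Fin k, D.rtConst j * gaussNorm P D.mu0sq D.a j) := by
  refine D.genFn335C_eq_auxE_sub_log hmu ha hL hk m2 e' l' Ak φ (ne_of_gt ?_)
  have hq : 0 ≤ l' * (D.toData14 m2).lamRun := by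
    show 0 ≤ l' * 1
    rw [mul_one]; exact hl
  have hreg' : 0 < l' * (D.toData14 m2).lamRun ∨ ∀ x ∈ (D.toData14 m2).Ω₁, 0 < (D.toData14 m2).m2 + (D.toData14 m2).dm2 e' l' x := by
    rcases hreg with h | h
    · left; show 0 < l' * 1; rw [mul_one]; exact h
    · right; intro x _; show 0 < m2 + (D.dm2 e' l' - m2); linarith
  exact B3Eq14Finite.integral_integrand14_pos (D.toData14 m2) hmu ha hL hk1 hk hm2 one_ne_zero hq hreg' Ak φ

end Data335

end Normalised

/-! ## 6. (3.36): the action `S^{(k),L^kε}` built on `E_k` -/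

section Action

variable {k : ℕ} (D : Data335 P N k)

namespace Data335

/-- **(3.36)** p. 618 [PDF 16] WITH BODY — `S^{(k),L^kε}(A, φ) = ½⟨A, Δ^{(k),L^kε}A⟩ + Σ_{0≦α+β≦n̄}(1/(α!β!))e^αλ^β
(∂^{α+β}/∂e′^α∂λ′^β)E_k(e′, λ′, eA^{(k),ε}, φ)|_{e′=λ′=0}`: `Δ^{(k),L^kε}` = the vector-field operator (2.17)/(2.21) (typer
`HiggsFluctMeasure.deltaK`, acting on the `ℝ^d`-valued site function of `A`, p. 608), `A^{(k),ε} = a_k(L^kε)^{−2}G^ε_kQ_k^*A`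
(3.29) = r15's `B3MultiscaleFields.topPiece`, `E_k = genFn335C`, the Taylor sum = r12's `B1Sect3Statements.pertSum362R` (the
one-sided reading of record of B1.Eq3.36 v1.1: `λ′`-derivatives from the right at `0⁺`); `e`, `λ` the couplings, `n̄` the
order. [cite: Balaban1982Higgs1, (3.36) p.618] -/
noncomputable def action336C (e lam : ℝ) (nbar : ℕ) (A : HiggsLattice.VecField P k) (φ : HiggsLattice.ScalarField P k N) : ℝ :=
  1 / 2 * siteInner (toSite A) (HiggsFluctMeasure.deltaK P D.mu0sq D.a k (toSite A))
    + B1Sect3Statements.pertSum362R (fun e' l' => D.genFn335C e' l' (e • topPiece D.mu0sq D.a k A) φ) e lam nbar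

/-- Unfolding of `action336C` = (3.36) as printed. [cite: Balaban1982Higgs1, (3.36) p.618] -/
theorem action336C_eq (e lam : ℝ) (nbar : ℕ) (A : HiggsLattice.VecField P k) (φ : HiggsLattice.ScalarField P k N) :
    D.action336C e lam nbar A φ
      = 1 / 2 * siteInner (toSite A) (HiggsFluctMeasure.deltaK P D.mu0sq D.a k (toSite A))
          + B1Sect3Statements.pertSum362R (fun e' l' => D.genFn335C e' l' (e • topPiece D.mu0sq D.a k A) φ) e lam nbar :=
  rfl

/-- **r12's (3.36) of record HOLDS for the action built on (3.35)**: `B1Sect3Statements.Eq336R S ⟨A,Δ^{(k)}A⟩ E_k e λ n̄`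
with `S = action336C …`, `E_k = (e′,λ′) ↦ genFn335C e′ λ′ (eA^{(k),ε}) φ` (by construction). [cite: Balaban1982Higgs1, (3.36) p.618] -/
theorem eq336R_action336C (e lam : ℝ) (nbar : ℕ) (A : HiggsLattice.VecField P k) (φ : HiggsLattice.ScalarField P k N) :
    B1Sect3Statements.Eq336R (D.action336C e lam nbar A φ) (siteInner (toSite A) (HiggsFluctMeasure.deltaK P D.mu0sq D.a k (toSite A)))
      (fun e' l' => D.genFn335C e' l' (e • topPiece D.mu0sq D.a k A) φ) e lam nbar :=
  rfl

end Data335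

end Action

end Literature.MathematicalPhysics.QuantumFieldTheory.Balaban1983to89.B1Eq335GeneratingFunction
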